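import Literature.MathematicalPhysics.QuantumFieldTheory.Balaban1983to89.Node00.BgHierFrameOfRecord
import HarnessLib

/-!
# `Balaban1983to89.Node00.BgHierFrameGLOfRecord` — [Balaban1985Averaging] (78)–(81) p. 30, (84)–(88) pp. 30–31, (92) p. 31; [Balaban1985BackgroundPropagators]
# (3.18)–(3.19) p. 393, (3.113)–(3.115) p. 418; [Balaban1985Variational] (21) p. 281, p. 307: THE `GL(N, ℂ)`-COMPLETED HIERARCHICAL FRAME OF RECORD
# `h(V) = e^{−F_k(σ_V)}·Ψ_k(V♮)` AND ITS GERM ALONG GAUGE ORBITS FOR EVERY MATRIX DIRECTION (file A1′ of the `(ρ-frame-min)` edition)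

Honest framing: statement-level constructions over the tree's letters with citation tags; every `theorem` below is proved (no `sorry`, standard
axioms); nothing here is a claim about the Yang–Mills mass gap.  Cell `pub-ymgap`, seat `pub-ymgap-node00-def-Y` (custodian of the Node00 instance of
record), director-ym ★★★ №608 ∕ №612 ∕ №617.  Count-neutral: no `KProved` moves, K0ᴬ is NOT closed, N06∕N07 are NOT discharged; finite `𝕋⁴` at fixed `ε`;
nothing continuum ∕ OS ∕ Clay.

WHY THIS FILE.  File A1 (`Node00.BgHierFrameOfRecord`) constructed print's hierarchical frame `(Φ_k, Ψ_k) = (R^{(k)}, (R^{(k)})⁻¹)` of (84)–(87) through the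
tree's HOLOMORPHIC averaging letters `holMh` ∕ `iterMh`, which continue inverses by ADJUGATES.  Adjugates are `SL(N, ℂ)`- but not `GL(N, ℂ)`-covariant
(`adj(e^{τ}W) = e^{(N−1)τ}·adj W`), so A1's germ (F1) `Dh(D_{U₀}λ) = λ∘emb^k − Q′_kλ` and (3.114) hold for TRACELESS `λ` — print's `𝔤ᶜ = 𝔰𝔩_N(ℂ)` verbatim —
while the tree's carriers are `M_N(ℂ) = 𝔰𝔩_N ⊕ ℂ·1`-valued and file A2's all-matrix display `FrameIntertwinesTok` also quantifies over the scalar direction.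
This file types the `GL(N, ℂ)`-COMPLETION of the frame, on which (F1) holds for EVERY matrix-valued `λ`:

* §1  the ABELIAN letters — the signed sum `walkSumL` of a scalar bond field along a walk (UST's `walkSum` as a `ℂ`-linear functional), the abelian
  one-step averaging `avgSumL` (`|I|⁻¹ Σ_i` flux through the (0.4) loops `+` the axial sum: the logarithm of (0.4) on `ℂˣ`-valued fields with TRUE
  inverses), its iterate `iterSumL k`, the scalar block mean `blockMeanIter k` (print's `Q′_k` on `ℂ·1`, `siteAvgIter_smul_one`), and the ABELIAN FRAME
  FUNCTIONAL `abFrameL k` — the recursion (84)–(88) on `ℂˣ`-valued fields in logarithmic coordinates: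
  `f₀ = 0`, `f_{j+1}(s)(y) = L^{-d} Σ_{x∈B(y)} [ s^{(j)}(Γ_{y,x}) + f_j(s)(x) ]` (`s^{(j)} = iterSumL j s`, same centre contours `Γ_{y,x}` as A1) — with the
  gradient identities `iterSumL_abGrad` (`(dφ)^{(j)} = d(φ∘emb^j)`: fluxes of gradients vanish, axial sums telescope) and ★ `abFrameL_abGrad`
  (`f_k(dφ) = M_kφ − φ∘emb^k`);
* §2  the DETERMINANT COORDINATE `σ_V(b) = N⁻¹·tr log(V(b)·U₀(b)⋆)` (`detLogField`, analytic on the log-disc `‖V(b)U₀(b)⋆ − 1‖ < 1`) and the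
  det-normalisation `V♮(b) = e^{−σ_V(b)}·V(b)` (`naturalField`; `(↑U₀)♮ = ↑U₀`), with their derivatives along the gauge orbit `t ↦ (exp tλ) • ↑U₀`:
  `σ̇ = −d(N⁻¹ tr λ)`, `(V♮)˙ =` the velocity of the TRACELESS part `λ₀ = λ − (N⁻¹ tr λ)·1`;
* §3  ★★★ the datum `hierFrameGLDatumOfRecord F N k U₀ : FrameDatum (F.P K) N k U₀`: `map V y = exp(−f_k(σ_V)(y)) • Ψ_k(V♮)(y)`,
  `inv V y = exp(f_k(σ_V)(y)) • Φ_k(V♮)(y)`, window = log-discs ∩ `♮⁻¹`(A1's iterated polydisc), `deriv = fderiv ℂ map (↑U₀)`, under the record's guard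
  `SmallBelow (avOfRecord F N K) k U₀` (off it: the frameless datum, as in A1); §3b: on fields with `σ_V = 0` (print's `SL(N, ℂ)`-valued
  configurations) `V♮ = V`, `f_k(σ_V) = 0` and the completed datum's `map` ∕ `inv` ARE A1's `Ψ_k` ∕ `Φ_k`
  (`hierFrameGLDatumOfRecord_eq_hierFrame_of_detLogField_eq_zero`) — the completion changes nothing on `Gᶜ = SL(N, ℂ)`;
* §4  ★★★ (F1) FOR EVERY MATRIX DIRECTION: `hierFrameGL_deriv_gauge (hU₀) (lam) : 𝔥ᴳᴸ.deriv (leftVelC U₀ (D_{U₀}λ)) = λ∘emb^k − Q′_kλ` — no trace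
  hypothesis (chain rule at `↑U₀`: the scalar channel goes through `σ` and `abFrameL_abGrad`, the traceless channel through `♮` and A1's
  `hierFrame_deriv_gauge`, and `Q′_k(φ·1) = (M_kφ)·1`);
* §5  (3.114) on `𝔰𝔩_N`-valued `λ` for this datum (`frameIntertwinesTokSL_hierFrameGL`), and the all-matrix display REDUCED TO ONE UN-FRAMED ROW:
  `frameIntertwinesTok_hierFrameGL_of_scalarRow` proves file A2's `FrameIntertwinesTok F N k U₀ 𝔥ᴳᴸ` FROM the un-framed scalar-channel row
  `q^{ff}(D_{U₀}(φ·1))(c) = L^{-k}·(φ(emb^k c₊) − φ(emb^k c₋))·1` taken as a HYPOTHESIS (the `U(1)`-phase covariance of (0.4); a Summits-side theorem of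
  the N07 trace-sector ∕ phase-equivariance files, not importable here) — nothing in this file asserts that row.

Nothing of Bałaban's estimates ((81), (20)–(23) of [Balaban1985Averaging]) is proved here: analyticity on the window and first-order identities only.
-/

noncomputable section

open scoped Matrix Matrix.Norms.L2Operator Topology

namespace Literature.MathematicalPhysics.QuantumFieldTheory.Balaban1983to89.Node00

open Filter
open T4Continuum BlockAveraging B15DeterminingSets
open MatrixLog (mlog mlog_one)
open BlockAveragingEMLLinearised (walkSum walkSum_nil walkSum_cons walkSum_grad)

/-! ## §1. Abelian letters: signed sums, the abelian averaging iterate, the scalar block mean, the abelian frame functional -/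

section Abelian

variable {P : Params} {j : ℕ}

/-- The signed sum `s(Γ) = Σ_{b⊂Γ} ±s_b` of a SCALAR bond field along a sequence of oriented steps, as a `ℂ`-linear functional (UST's `walkSum`).
[cite: Balaban1984PropagatorsI, (1.8) p.19; Balaban1985Averaging, (78) p.30] -/
def walkSumL (γ : List (LStep P j)) : (PBond P j → ℂ) →ₗ[ℂ] ℂ where
  toFun s := walkSum s γ
  map_add' s t := by
    induction γ with
    | nil => simp
    | cons st γ ih =>
      simp only [walkSum_cons, Pi.add_apply, ih]
      split_ifs <;> ring
  map_smul' a s := by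
    induction γ with
    | nil => simp
    | cons st γ ih =>
      simp only [walkSum_cons, Pi.smul_apply, smul_eq_mul, RingHom.id_apply, ih]
      split_ifs <;> ring

/-- Unfolding of `walkSumL` (`rfl`). [cite: Balaban1984PropagatorsI, (1.8) p.19 (bookkeeping)] -/
theorem walkSumL_apply (γ : List (LStep P j)) (s : PBond P j → ℂ) : walkSumL γ s = walkSum s γ := rfl

/-- The lattice gradient of a scalar site function, tree convention `(dφ)_b = φ(b₊) − φ(b₋)`. [cite: Balaban1984PropagatorsI, (1.9) p.19] -/
def abGrad (φ : Site P j → ℂ) : PBond P j → ℂ := fun b => φ b.tgt - φ b.src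

/-- Unfolding of `abGrad` (`rfl`). [cite: Balaban1984PropagatorsI, (1.9) p.19 (bookkeeping)] -/
theorem abGrad_apply (φ : Site P j → ℂ) (b : PBond P j) : abGrad φ b = φ b.tgt - φ b.src := rfl

/-- Telescoping: `(dφ)(walk from x spelled by w) = φ(end) − φ(x)` (UST's `walkSum_grad`). [cite: Balaban1984PropagatorsI, (1.9) p.19] -/
theorem walkSumL_abGrad (φ : Site P j → ℂ) (x : Site P j) (w : List (Letter P.d)) : walkSumL (walk x w) (abGrad φ) = φ (walkEnd x w) - φ x :=
  walkSum_grad φ x w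

/-- The abelian flux through the (0.4) loop `i` at the coarse bond `c`. [cite: Balaban1987RG1, (0.4) p.253; Balaban1984PropagatorsI, (1.8) p.19] -/
def loopSumL (c : PBond P (j + 1)) (i : Idx P) : (PBond P j → ℂ) →ₗ[ℂ] ℂ :=
  walkSumL (walk (emb c.src) (loopWord P.L c.dir (off i.1) i.2.1 i.2.2))

/-- The abelian sum along the straight segment `[c₋, c₊]`. [cite: Balaban1987RG1, (0.4) p.253; Balaban1984PropagatorsI, (1.8) p.19] -/
def axialSumL (c : PBond P (j + 1)) : (PBond P j → ℂ) →ₗ[ℂ] ℂ :=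
  walkSumL (walk (emb c.src) (List.replicate P.L (c.dir, true)))

/-- ★ **THE ABELIAN ONE-STEP AVERAGING** `(s ↦ |I|⁻¹ Σ_i s(loop_i) + s([c₋, c₊]))`: the logarithm of (0.4) on `ℂˣ`-valued fields `e^{s}` with TRUE inverses
(scalars commute, logarithms add). [cite: Balaban1987RG1, (0.4) p.253; Balaban1985Averaging, (11) p.19] -/
def avgSumL : (PBond P j → ℂ) →ₗ[ℂ] (PBond P (j + 1) → ℂ) :=
  LinearMap.pi fun c => ((Fintype.card (Idx P) : ℂ))⁻¹ • (∑ i : Idx P, loopSumL c i) + axialSumL c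

/-- Unfolding of `avgSumL`. [cite: Balaban1987RG1, (0.4) p.253 (bookkeeping)] -/
theorem avgSumL_apply (s : PBond P j → ℂ) (c : PBond P (j + 1)) :
    avgSumL s c = ((Fintype.card (Idx P) : ℂ))⁻¹ * (∑ i : Idx P, loopSumL c i s) + axialSumL c s := by
  simp [avgSumL, LinearMap.sum_apply]

/-- Fluxes of gradients vanish (the (0.4) loops are closed: `netDisp_loopWord`). [cite: Balaban1987RG1, (0.4) p.253; Balaban1984PropagatorsI, (1.9) p.19] -/
theorem loopSumL_abGrad (φ : Site P j → ℂ) (c : PBond P (j + 1)) (i : Idx P) : loopSumL c i (abGrad φ) = 0 := by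
  rw [loopSumL, walkSumL_abGrad, walkEnd_eq_self_of_netDisp, sub_self]
  intro ν
  rw [netDisp_loopWord, Int.cast_zero]

/-- Axial sums of gradients telescope: `(dφ)([c₋, c₊]) = φ(emb c₊) − φ(emb c₋)`. [cite: Balaban1984PropagatorsI, (1.9) p.19; Balaban1987RG1, (0.3) p.252] -/
theorem axialSumL_abGrad (φ : Site P j → ℂ) (c : PBond P (j + 1)) : axialSumL c (abGrad φ) = φ (emb c.tgt) - φ (emb c.src) := by
  rw [axialSumL, walkSumL_abGrad, walkEnd_replicate_L]
  rfl

/-- ★ **THE ABELIAN AVERAGE OF A PURE GAUGE IS THE PURE GAUGE OF THE RESTRICTED FUNCTION**: `avgSumL (dφ) = d(φ∘emb)` ((11) on `ℂˣ`, logarithmic form).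
[cite: Balaban1985Averaging, (11) p.19; Balaban1987RG1, (0.4) p.253] -/
theorem avgSumL_abGrad (φ : Site P j → ℂ) : avgSumL (abGrad φ) = abGrad fun y : Site P (j + 1) => φ (emb y) := by
  funext c
  rw [avgSumL_apply, abGrad_apply]
  simp [loopSumL_abGrad, axialSumL_abGrad]

/-- The abelian sum along the centre contour `Γ_{y,x_r}` of file 3b (`ctrWord`). [cite: Balaban1985Averaging, (78) p.30; Balaban1985BackgroundPropagators, (3.18) p.393] -/
def ctrSumL (y : Site P (j + 1)) (r : Fin P.d → Fin P.L) : (PBond P j → ℂ) →ₗ[ℂ] ℂ :=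
  walkSumL (walk (emb y) (ctrWord P r))

/-- Centre-contour sums of gradients telescope to `φ(x_r) − φ(ey)` (`walkEnd_emb_ctrWord`). [cite: Balaban1985Averaging, (78) p.30; Balaban1984PropagatorsI, (1.9) p.19] -/
theorem ctrSumL_abGrad (φ : Site P j → ℂ) (y : Site P (j + 1)) (r : Fin P.d → Fin P.L) :
    ctrSumL y r (abGrad φ) = φ (Site.blockSite y r) - φ (emb y) := by
  rw [ctrSumL, walkSumL_abGrad, walkEnd_emb_ctrWord]

end Abelian

section AbelianIter

variable {P : Params}

/-- ★ **THE ABELIAN `k`-FOLD AVERAGING ITERATE** `s ↦ s^{(k)}` (logarithm of (88) on `ℂˣ`-valued fields). [cite: Balaban1985Averaging, (88) p.31; Balaban1987RG1, (0.21) p.256] -/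
def iterSumL : (k : ℕ) → ((PBond P 0 → ℂ) →ₗ[ℂ] (PBond P k → ℂ))
  | 0 => LinearMap.id
  | k + 1 => avgSumL ∘ₗ iterSumL k

/-- `(dφ)^{(k)} = d(φ∘emb^k)`. [cite: Balaban1985Averaging, (11) p.19, (88) p.31] -/
theorem iterSumL_abGrad (φ : Site P 0 → ℂ) : ∀ k : ℕ, iterSumL k (abGrad φ) = abGrad fun y : Site P k => φ (embIter k y)
  | 0 => rfl
  | k + 1 => by
    rw [iterSumL, LinearMap.comp_apply, iterSumL_abGrad φ k, avgSumL_abGrad]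
    rfl

/-- ★ **THE SCALAR BLOCK-MEAN ITERATE `M_k`** (print's `Q′_k` (3.19) on the scalar channel `ℂ·1`, where the rotations `R(U(Γ))` act trivially:
`siteAvgIter_smul_one`): `M₀ = id`, `(M_{k+1}φ)(y) = L^{-d} Σ_{x∈B(y)} (M_kφ)(x)`. [cite: Balaban1985BackgroundPropagators, (3.18)–(3.19) p.393] -/
def blockMeanIter : (k : ℕ) → (Site P 0 → ℂ) → Site P k → ℂ
  | 0 => id
  | k + 1 => fun φ y => ((P.L : ℂ) ^ P.d)⁻¹ * ∑ r : Fin P.d → Fin P.L, blockMeanIter k φ (Site.blockSite y r)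

/-- `M₀ = id` (`rfl`). [cite: Balaban1985BackgroundPropagators, (3.19) p.393 (bookkeeping)] -/
@[simp] theorem blockMeanIter_zero (φ : Site P 0 → ℂ) : blockMeanIter 0 φ = φ := rfl

/-- The recursion of `M_k` (`rfl`). [cite: Balaban1985BackgroundPropagators, (3.19) p.393 (bookkeeping)] -/
theorem blockMeanIter_succ_apply (k : ℕ) (φ : Site P 0 → ℂ) (y : Site P (k + 1)) :
    blockMeanIter (k + 1) φ y = ((P.L : ℂ) ^ P.d)⁻¹ * ∑ r : Fin P.d → Fin P.L, blockMeanIter k φ (Site.blockSite y r) := rfl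

/-- ★ **THE ABELIAN FRAME FUNCTIONAL `f_k`** — the recursion (84)–(88) on `ℂˣ`-valued fields in logarithmic coordinates (TRUE inverses = minus signs):
`f₀ = 0`, `f_{j+1}(s)(y) = L^{-d} Σ_{x ∈ B(y)} [ s^{(j)}(Γ_{y,x}) + f_j(s)(x) ]` — the exponent `log Φ^{ab}_k` of the abelian frame; with it
`Φ^{ab}_{j+1}(y) = Φ^{ab}_j(ey)·exp E_{j+1}(y)`, `E_{j+1}(y) = L^{-d} Σ_x [−f_j(ey) + s^{(j)}(Γ_{y,x}) + f_j(x)]`, exactly (85)–(86) with the background `1`.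
[cite: Balaban1985Averaging, (84)–(88) pp.30–31, (78)–(79) p.30] -/
def abFrameL : (k : ℕ) → ((PBond P 0 → ℂ) →ₗ[ℂ] (Site P k → ℂ))
  | 0 => 0
  | k + 1 => LinearMap.pi fun y : Site P (k + 1) =>
      ((P.L : ℂ) ^ P.d)⁻¹ • ∑ r : Fin P.d → Fin P.L, (ctrSumL y r ∘ₗ iterSumL k + LinearMap.proj (Site.blockSite y r) ∘ₗ abFrameL k)

/-- `f₀ = 0` (`rfl`). [cite: Balaban1985Averaging, (84) p.30 (bookkeeping)] -/
@[simp] theorem abFrameL_zero : (abFrameL 0 : (PBond P 0 → ℂ) →ₗ[ℂ] (Site P 0 → ℂ)) = 0 := rfl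

/-- The recursion of `f_k`, unfolded. [cite: Balaban1985Averaging, (85)–(86) pp.30–31 (bookkeeping)] -/
theorem abFrameL_succ_apply (k : ℕ) (s : PBond P 0 → ℂ) (y : Site P (k + 1)) :
    abFrameL (k + 1) s y = ((P.L : ℂ) ^ P.d)⁻¹ * ∑ r : Fin P.d → Fin P.L, (ctrSumL y r (iterSumL k s) + abFrameL k s (Site.blockSite y r)) := by
  simp [abFrameL, LinearMap.sum_apply]

/-- `L^{-d} Σ_{x∈B(y)} (a(x) − c) = L^{-d} Σ_x a(x) − c` (there are `L^d` sites in a block). [cite: Balaban1985Averaging, (79) p.30 (bookkeeping)] -/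
theorem invLd_mul_sum_sub_const (a : (Fin P.d → Fin P.L) → ℂ) (c : ℂ) :
    ((P.L : ℂ) ^ P.d)⁻¹ * ∑ r : Fin P.d → Fin P.L, (a r - c) = ((P.L : ℂ) ^ P.d)⁻¹ * ∑ r : Fin P.d → Fin P.L, a r - c := by
  have hL : ((P.L : ℂ) ^ P.d) ≠ 0 := pow_ne_zero _ (Nat.cast_ne_zero.2 P.L_pos.ne')
  rw [Finset.sum_sub_distrib, Finset.sum_const, Finset.card_univ, Fintype.card_fun, Fintype.card_fin, Fintype.card_fin, nsmul_eq_mul, mul_sub]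
  push_cast
  rw [inv_mul_cancel_left₀ hL]

/-- ★★ **THE GRADIENT IDENTITY OF THE ABELIAN FRAME**: `f_k(dφ) = M_kφ − φ∘emb^k` — along a pure gauge the abelian frame exponent is the block mean minus
the centre value (print's p. 418 «`R_y(U′_u) = u(y)·exp[−Σ_x L^{-d} log u(x)]`» in logarithmic form, iterated along (3.19)).
[cite: Balaban1985BackgroundPropagators, (3.113)–(3.114) p.418, (3.19) p.393; Balaban1985Averaging, (84)–(87) pp.30–31] -/
theorem abFrameL_abGrad (φ : Site P 0 → ℂ) : ∀ k : ℕ, abFrameL k (abGrad φ) = fun y : Site P k => blockMeanIter k φ y - φ (embIter k y)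
  | 0 => by
    funext y
    simp [embIter]
  | k + 1 => by
    funext y
    rw [abFrameL_succ_apply, iterSumL_abGrad, blockMeanIter_succ_apply, show embIter (k + 1) y = embIter k (emb y) from rfl]
    simp only [ctrSumL_abGrad, abFrameL_abGrad φ k]
    rw [Finset.sum_congr rfl fun r _ =>
      show φ (embIter k (Site.blockSite y r)) - φ (embIter k (emb y)) + (blockMeanIter k φ (Site.blockSite y r) - φ (embIter k (Site.blockSite y r))) =
        blockMeanIter k φ (Site.blockSite y r) - φ (embIter k (emb y)) from by ring]
    exact invLd_mul_sum_sub_const _ _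

variable {N : ℕ} [NeZero N]

/-- ★ **PRINT'S `Q′_k` ON THE SCALAR CHANNEL IS THE BLOCK MEAN**: `Q′_k(U₀)(φ·1) = (M_kφ)·1` (the rotations `R(U(Γ_{y,x}))` fix `ℂ·1`).
[cite: Balaban1985BackgroundPropagators, (3.18)–(3.19) p.393] -/
theorem siteAvgIter_smul_one (av : ∀ j, Averaging P j (SU N)) (U₀ : GaugeField P 0 (SU N)) (φ : Site P 0 → ℂ) :
    ∀ k : ℕ, siteAvgIter av U₀ k (fun x => φ x • (1 : Matrix (Fin N) (Fin N) ℂ)) = fun y => blockMeanIter k φ y • (1 : Matrix (Fin N) (Fin N) ℂ)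
  | 0 => rfl
  | k + 1 => by
    funext y
    rw [siteAvgIter_succ, LinearMap.comp_apply, siteAvgIter_smul_one av U₀ φ k, siteAvgStep_apply, blockMeanIter_succ_apply, Finset.mul_sum,
      Finset.sum_smul]
    refine Finset.sum_congr rfl fun r _ => ?_
    rw [Matrix.mul_smul, mul_one, Matrix.smul_mul, coe_mul_star_coe_SU, smul_smul]

end AbelianIter

/-! ## §2. The determinant coordinate `σ` and the det-normalisation `♮` -/

section DetLog

variable {P : Params} {N : ℕ} (U₀ : GaugeField P 0 (SU N))

/-- ★ **THE DETERMINANT COORDINATE** `σ_V(b) = N⁻¹·tr log(V(b)·U₀(b)⋆)` of a complexified bond field relative to the background (`= N⁻¹ log det(V(b)U₀(b)⋆)`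
on the log-disc; `σ_{↑U₀} = 0`). [cite: Balaban1985Variational, p.307 («`Gᶜ`-valued fields»), (15) p.280; Balaban1985Averaging, (21) p.21] -/
def detLogField (V : PBond P 0 → Matrix (Fin N) (Fin N) ℂ) : PBond P 0 → ℂ :=
  fun b => ((N : ℂ))⁻¹ * (mlog (V b * star (U₀ b : Matrix (Fin N) (Fin N) ℂ))).trace

/-- Unfolding of `detLogField` (`rfl`). [cite: Balaban1985Variational, (15) p.280 (bookkeeping)] -/
theorem detLogField_apply (V : PBond P 0 → Matrix (Fin N) (Fin N) ℂ) (b : PBond P 0) :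
    detLogField U₀ V b = ((N : ℂ))⁻¹ * (mlog (V b * star (U₀ b : Matrix (Fin N) (Fin N) ℂ))).trace := rfl

/-- `σ_{↑U₀} = 0`. [cite: Balaban1985Variational, (21) p.281 (bookkeeping)] -/
@[simp] theorem detLogField_coeField : detLogField U₀ (coeField U₀) = 0 := by
  funext b
  rw [detLogField_apply, coeField_apply, coe_mul_star_coe_SU, mlog_one, Matrix.trace_zero, mul_zero, Pi.zero_apply]

/-- ★ **THE DET-NORMALISATION** `V♮(b) = e^{−σ_V(b)}·V(b)` (on the log-disc `det(V♮(b)U₀(b)⋆) = 1`: on `V♮` adjugates are inverses).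
[cite: Balaban1985Variational, p.307 («`Gᶜ`-valued fields»), (15) p.280] -/
def naturalField (V : PBond P 0 → Matrix (Fin N) (Fin N) ℂ) : PBond P 0 → Matrix (Fin N) (Fin N) ℂ :=
  fun b => Complex.exp (-detLogField U₀ V b) • V b

/-- Unfolding of `naturalField` (`rfl`). [cite: Balaban1985Variational, (15) p.280 (bookkeeping)] -/
theorem naturalField_apply (V : PBond P 0 → Matrix (Fin N) (Fin N) ℂ) (b : PBond P 0) :
    naturalField U₀ V b = Complex.exp (-detLogField U₀ V b) • V b := rfl

/-- `(↑U₀)♮ = ↑U₀`. [cite: Balaban1985Variational, (21) p.281 (bookkeeping)] -/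
@[simp] theorem naturalField_coeField : naturalField U₀ (coeField U₀) = coeField U₀ := by
  funext b
  rw [naturalField_apply, detLogField_coeField, Pi.zero_apply, neg_zero, Complex.exp_zero, one_smul]

/-- `σ_V = 0 ⟹ V♮ = V` (the normalisation is the identity on fields of vanishing determinant coordinate). [cite: Balaban1985Variational, p.307 (bookkeeping)] -/
theorem naturalField_of_detLogField_eq_zero {V : PBond P 0 → Matrix (Fin N) (Fin N) ℂ} (hσ : detLogField U₀ V = 0) : naturalField U₀ V = V := by
  funext b
  rw [naturalField_apply, hσ, Pi.zero_apply, neg_zero, Complex.exp_zero, one_smul]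

/-- The trace is analytic (a continuous linear functional). [cite: Balaban1985Averaging, (21) p.21 (bookkeeping)] -/
theorem analyticAt_trace (A : Matrix (Fin N) (Fin N) ℂ) : AnalyticAt ℂ (fun M : Matrix (Fin N) (Fin N) ℂ => M.trace) A :=
  (LinearMap.toContinuousLinearMap (Matrix.traceLinearMap (Fin N) ℂ ℂ)).analyticAt A

/-- `σ_V(b)` is analytic in `V` on the log-disc `‖V(b)U₀(b)⋆ − 1‖ < 1`. [cite: Balaban1985Variational, Prop. 9 p.309; Balaban1985Averaging, (21) p.21] -/
theorem analyticAt_detLogField {V : PBond P 0 → Matrix (Fin N) (Fin N) ℂ} (b : PBond P 0)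
    (hV : ‖V b * star (U₀ b : Matrix (Fin N) (Fin N) ℂ) - 1‖ < 1) : AnalyticAt ℂ (fun V => detLogField U₀ V b) V := by
  have hb : AnalyticAt ℂ (fun V : PBond P 0 → Matrix (Fin N) (Fin N) ℂ => V b * star (U₀ b : Matrix (Fin N) (Fin N) ℂ)) V :=
    ((ContinuousLinearMap.proj (R := ℂ) (φ := fun _ : PBond P 0 => Matrix (Fin N) (Fin N) ℂ) b).analyticAt V).mul analyticAt_const
  exact analyticAt_const.mul ((analyticAt_trace _).comp (analyticAt_mlog_comp hb hV))

/-- `V♮` is analytic in `V` on the log-discs. [cite: Balaban1985Variational, Prop. 9 p.309] -/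
theorem analyticAt_naturalField {V : PBond P 0 → Matrix (Fin N) (Fin N) ℂ} (hV : ∀ b, ‖V b * star (U₀ b : Matrix (Fin N) (Fin N) ℂ) - 1‖ < 1) :
    AnalyticAt ℂ (naturalField U₀) V :=
  analyticAt_pi_iff.2 fun b =>
    (analyticAt_detLogField U₀ b (hV b)).neg.cexp.smul
      ((ContinuousLinearMap.proj (R := ℂ) (φ := fun _ : PBond P 0 => Matrix (Fin N) (Fin N) ℂ) b).analyticAt V)

/-- ★ **`σ` ALONG THE GAUGE ORBIT**: `d/dt|₀ σ_{(exp tλ)•↑U₀}(b) = N⁻¹·(tr λ(b₋) − tr λ(b₊))` — minus the gradient of `φ = N⁻¹ tr λ`.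
[cite: Balaban1985BackgroundPropagators, (3.113) p.418; Balaban1985Averaging, (8) p.18] -/
theorem hasDerivAt_detLogField_slOrbit (lam : Site P 0 → Matrix (Fin N) (Fin N) ℂ) (b : PBond P 0) :
    HasDerivAt (fun t : ℂ => detLogField U₀ (slOrbit U₀ lam t) b) (((N : ℂ))⁻¹ * ((lam b.src).trace - (lam b.tgt).trace)) 0 := by
  have hV : HasDerivAt (fun t : ℂ => slOrbit U₀ lam t b * star (U₀ b : Matrix (Fin N) (Fin N) ℂ))
      ((lam b.src * (U₀ b : Matrix (Fin N) (Fin N) ℂ) - (U₀ b : Matrix (Fin N) (Fin N) ℂ) * lam b.tgt) * star (U₀ b : Matrix (Fin N) (Fin N) ℂ)) 0 :=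
    ((hasDerivAt_pi.1 (hasDerivAt_slOrbit_zero U₀ lam)) b).mul_const _
  have h0 : slOrbit U₀ lam 0 b * star (U₀ b : Matrix (Fin N) (Fin N) ℂ) = 1 := by
    rw [slOrbit_zero, coeField_apply, coe_mul_star_coe_SU]
  have hlog : HasDerivAt (fun t : ℂ => mlog (slOrbit U₀ lam t b * star (U₀ b : Matrix (Fin N) (Fin N) ℂ)))
      ((lam b.src * (U₀ b : Matrix (Fin N) (Fin N) ℂ) - (U₀ b : Matrix (Fin N) (Fin N) ℂ) * lam b.tgt) * star (U₀ b : Matrix (Fin N) (Fin N) ℂ)) 0 := by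
    have h := (mlog_hasFDerivAt_one (N := N)).comp_hasDerivAt_of_eq (0 : ℂ) hV h0.symm
    exact h.congr_deriv (by rw [ContinuousLinearMap.coe_id', id_eq])
  have htr : HasDerivAt (fun t : ℂ => (mlog (slOrbit U₀ lam t b * star (U₀ b : Matrix (Fin N) (Fin N) ℂ))).trace)
      ((lam b.src).trace - (lam b.tgt).trace) 0 := by
    have h := (LinearMap.toContinuousLinearMap (Matrix.traceLinearMap (Fin N) ℂ ℂ)).hasFDerivAt.comp_hasDerivAt (0 : ℂ) hlog
    have htr' : ((lam b.src * (U₀ b : Matrix (Fin N) (Fin N) ℂ) - (U₀ b : Matrix (Fin N) (Fin N) ℂ) * lam b.tgt) *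
        star (U₀ b : Matrix (Fin N) (Fin N) ℂ)).trace = (lam b.src).trace - (lam b.tgt).trace := by
      rw [sub_mul, Matrix.trace_sub, mul_assoc, coe_mul_star_coe_SU, mul_one, mul_assoc, Matrix.trace_mul_comm, mul_assoc, star_coe_mul_coe_SU,
        mul_one]
    rw [← htr']
    exact h
  show HasDerivAt (fun t : ℂ => ((N : ℂ))⁻¹ * (mlog (slOrbit U₀ lam t b * star (U₀ b : Matrix (Fin N) (Fin N) ℂ))).trace)
    (((N : ℂ))⁻¹ * ((lam b.src).trace - (lam b.tgt).trace)) 0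
  exact htr.const_mul ((N : ℂ))⁻¹

/-- ★ **`♮` ALONG THE GAUGE ORBIT**: `d/dt|₀ ((exp tλ)•↑U₀)♮ =` the velocity of the TRACELESS part `λ₀ = λ − (N⁻¹ tr λ)·1` (`λ₀(b₋)U₀(b) − U₀(b)λ₀(b₊)`).
[cite: Balaban1985BackgroundPropagators, (3.113) p.418; Balaban1985Variational, p.307] -/
theorem hasDerivAt_naturalField_slOrbit (lam : Site P 0 → Matrix (Fin N) (Fin N) ℂ) :
    HasDerivAt (fun t : ℂ => naturalField U₀ (slOrbit U₀ lam t))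
      (fun b : PBond P 0 =>
        (lam b.src - (((N : ℂ))⁻¹ * (lam b.src).trace) • (1 : Matrix (Fin N) (Fin N) ℂ)) * (U₀ b : Matrix (Fin N) (Fin N) ℂ) -
          (U₀ b : Matrix (Fin N) (Fin N) ℂ) * (lam b.tgt - (((N : ℂ))⁻¹ * (lam b.tgt).trace) • (1 : Matrix (Fin N) (Fin N) ℂ))) 0 := by
  refine hasDerivAt_pi.2 fun b => ?_
  have hσ := (hasDerivAt_detLogField_slOrbit U₀ lam b).neg.cexp
  have hV := (hasDerivAt_pi.1 (hasDerivAt_slOrbit_zero U₀ lam)) b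
  have h := hσ.smul hV
  have hσ0 : detLogField U₀ (slOrbit U₀ lam 0) b = 0 := by rw [slOrbit_zero, detLogField_coeField, Pi.zero_apply]
  have hV0 : slOrbit U₀ lam 0 b = (U₀ b : Matrix (Fin N) (Fin N) ℂ) := by rw [slOrbit_zero, coeField_apply]
  simp only [Pi.neg_apply, hσ0, neg_zero, Complex.exp_zero, one_smul, one_mul, hV0] at h
  have he : (lam b.src - (((N : ℂ))⁻¹ * (lam b.src).trace) • (1 : Matrix (Fin N) (Fin N) ℂ)) * (U₀ b : Matrix (Fin N) (Fin N) ℂ) -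
        (U₀ b : Matrix (Fin N) (Fin N) ℂ) * (lam b.tgt - (((N : ℂ))⁻¹ * (lam b.tgt).trace) • (1 : Matrix (Fin N) (Fin N) ℂ)) =
      lam b.src * (U₀ b : Matrix (Fin N) (Fin N) ℂ) - (U₀ b : Matrix (Fin N) (Fin N) ℂ) * lam b.tgt +
        -(((N : ℂ))⁻¹ * ((lam b.src).trace - (lam b.tgt).trace)) • (U₀ b : Matrix (Fin N) (Fin N) ℂ) := by
    simp only [sub_mul, mul_sub, Matrix.smul_mul, Matrix.mul_smul, one_mul, mul_one, neg_smul, sub_smul]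
    abel
  rw [he]
  exact h

end DetLog

/-! ## §3. The `GL(N, ℂ)`-completed datum of record -/

section RecordGL

variable (F : T4Family) (N : ℕ) [NeZero N] {K : ℕ} (k : ℕ) (U₀ : GaugeField (F.P K) 0 (SU N))

/-- The window of the completed frame: the log-discs of `σ` and the `♮`-preimage of A1's iterated polydisc. [cite: Balaban1985Averaging, (81) p.30; Balaban1985Variational, Prop. 9 p.309] -/
def hierFrameGLDom : Set (PBond (F.P K) 0 → Matrix (Fin N) (Fin N) ℂ) :=
  {V | (∀ b, ‖V b * star (U₀ b : Matrix (Fin N) (Fin N) ℂ) - 1‖ < 1) ∧ naturalField U₀ V ∈ hierFrameDom (avOfRecord F N K) U₀ k}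

/-- ★ **THE COMPLETED FRAME** `h(V)(y) = e^{−f_k(σ_V)(y)} • Ψ_k(V♮)(y)`. [cite: Balaban1985Averaging, (84)–(88) pp.30–31; Balaban1985Variational, (21) p.281, p.307] -/
def hierFrameGLMap (V : PBond (F.P K) 0 → Matrix (Fin N) (Fin N) ℂ) (y : Site (F.P K) k) : Matrix (Fin N) (Fin N) ℂ :=
  Complex.exp (-abFrameL k (detLogField U₀ V) y) • (framePair (avOfRecord F N K) U₀ (naturalField U₀ V) k y).2

/-- ★ **THE COMPLETED INVERSE FRAME** `h(V)⁻¹(y) = e^{f_k(σ_V)(y)} • Φ_k(V♮)(y)` (an explicit letter).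
[cite: Balaban1985Averaging, (84)–(88) pp.30–31; Balaban1985Variational, (21) p.281] -/
def hierFrameGLInv (V : PBond (F.P K) 0 → Matrix (Fin N) (Fin N) ℂ) (y : Site (F.P K) k) : Matrix (Fin N) (Fin N) ℂ :=
  Complex.exp (abFrameL k (detLogField U₀ V) y) • (framePair (avOfRecord F N K) U₀ (naturalField U₀ V) k y).1

/-- `h · h⁻¹ = 1` for EVERY field (`e^{−f}e^{f} = 1`, `Ψ_k·Φ_k = 1`). [cite: Balaban1985Averaging, (80) p.30, (86) p.31 (bookkeeping)] -/
theorem hierFrameGLMap_mul_inv (V : PBond (F.P K) 0 → Matrix (Fin N) (Fin N) ℂ) (y : Site (F.P K) k) :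
    hierFrameGLMap F N k U₀ V y * hierFrameGLInv F N k U₀ V y = 1 := by
  rw [hierFrameGLMap, hierFrameGLInv, smul_mul_smul_comm, framePair_snd_mul_fst, ← Complex.exp_add, neg_add_cancel, Complex.exp_zero, one_smul]

/-- The background lies in the completed window, under the guard. [cite: Balaban1985Averaging, (81) p.30 (bookkeeping)] -/
theorem coeField_mem_hierFrameGLDom {k : ℕ} (hU₀ : SmallBelow (avOfRecord F N K) k U₀) : coeField U₀ ∈ hierFrameGLDom F N k U₀ := by
  refine ⟨fun b => ?_, ?_⟩
  · rw [coeField_apply, coe_mul_star_coe_SU, sub_self, norm_zero]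
    exact one_pos
  · rw [naturalField_coeField]
    exact coeField_mem_hierFrameDom F N U₀ hU₀

/-- The completed window is a neighbourhood of the background. [cite: Balaban1985Averaging, (81) p.30; Balaban1985Variational, Prop. 9 p.309] -/
theorem hierFrameGLDom_mem_nhds {k : ℕ} (hU₀ : SmallBelow (avOfRecord F N K) k U₀) : hierFrameGLDom F N k U₀ ∈ 𝓝 (coeField U₀) := by
  have hmem := coeField_mem_hierFrameGLDom F N U₀ hU₀
  have hopen : IsOpen {X : Matrix (Fin N) (Fin N) ℂ | ‖X - 1‖ < 1} :=
    isOpen_lt (continuous_norm.comp (continuous_id.sub continuous_const)) continuous_const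
  refine Filter.inter_mem (Filter.eventually_all.2 fun b => ?_) ?_
  · have hc : ContinuousAt (fun V : PBond (F.P K) 0 → Matrix (Fin N) (Fin N) ℂ => V b * star (U₀ b : Matrix (Fin N) (Fin N) ℂ)) (coeField U₀) :=
      ((continuous_apply b).mul continuous_const).continuousAt
    exact hc.preimage_mem_nhds (hopen.mem_nhds (hmem.1 b))
  · have hc : ContinuousAt (naturalField U₀) (coeField U₀) := (analyticAt_naturalField U₀ hmem.1).continuousAt
    have ht : hierFrameDom (avOfRecord F N K) U₀ k ∈ 𝓝 (naturalField U₀ (coeField U₀)) := by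
      rw [naturalField_coeField]
      exact hierFrameDom_mem_nhds F N U₀ hU₀
    exact hc.preimage_mem_nhds ht

/-- Analyticity of the completed frame and inverse frame on the window. [cite: Balaban1985Variational, Prop. 9 p.309; Balaban1985Averaging, (81) p.30] -/
theorem analyticAt_hierFrameGL {V : PBond (F.P K) 0 → Matrix (Fin N) (Fin N) ℂ} (hV : V ∈ hierFrameGLDom F N k U₀) (y : Site (F.P K) k) :
    AnalyticAt ℂ (fun V => hierFrameGLMap F N k U₀ V y) V ∧ AnalyticAt ℂ (fun V => hierFrameGLInv F N k U₀ V y) V := by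
  have hσ : AnalyticAt ℂ (fun V => detLogField U₀ V) V := analyticAt_pi_iff.2 fun b => analyticAt_detLogField U₀ b (hV.1 b)
  have hf : AnalyticAt ℂ (fun V => abFrameL k (detLogField U₀ V) y) V :=
    ((LinearMap.toContinuousLinearMap ((LinearMap.proj y : (Site (F.P K) k → ℂ) →ₗ[ℂ] ℂ) ∘ₗ abFrameL k)).analyticAt _).comp hσ
  have hnat : AnalyticAt ℂ (naturalField U₀) V := analyticAt_naturalField U₀ hV.1
  have hfp := analyticAt_framePair (avOfRecord F N K) U₀ (V := naturalField U₀ V) k hV.2 y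
  exact ⟨hf.neg.cexp.smul (hfp.2.comp hnat), hf.cexp.smul (hfp.1.comp hnat)⟩

/-- At the background the completed frame is trivial, under the guard. [cite: Balaban1985Variational, (21) p.281 («R₀ = 1»)] -/
theorem hierFrameGLMap_coeField {k : ℕ} (hU₀ : SmallBelow (avOfRecord F N K) k U₀) : hierFrameGLMap F N k U₀ (coeField U₀) = 1 := by
  funext y
  rw [hierFrameGLMap, detLogField_coeField, map_zero, Pi.zero_apply, neg_zero, Complex.exp_zero, one_smul, naturalField_coeField,
    framePair_coeField_of_smallBelow F N U₀ hU₀ k le_rfl]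
  rfl

/-- ★★★ **THE `GL(N, ℂ)`-COMPLETED FRAME DATUM OF RECORD AT THE BACKGROUND `U₀`** — `map V y = e^{−f_k(σ_V)(y)} • Ψ_k(V♮)(y)`, `inv V y = e^{f_k(σ_V)(y)} • Φ_k(V♮)(y)`,
window = log-discs ∩ `♮⁻¹`(iterated polydisc), `deriv = fderiv ℂ map (↑U₀)`; DEFINED under the record's guard below `k` (outside it: the frameless datum).
Near `↑U₀` this IS print's frame (84)–(87) with true inverses on `GL(N, ℂ)`-valued fields (scalar factors commute through walk products, logarithms
and block means). [cite: Balaban1985Averaging, (78)–(81) p.30, (84)–(88) pp.30–31, (92) p.31; Balaban1985BackgroundPropagators, (3.113) p.418; Balaban1985Variational, (21) p.281, p.307] -/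
def hierFrameGLDatumOfRecord : FrameDatum (F.P K) N k U₀ := by
  classical
  exact if hU₀ : SmallBelow (avOfRecord F N K) k U₀ then
    { dom := hierFrameGLDom F N k U₀
      dom_mem_nhds := hierFrameGLDom_mem_nhds F N U₀ hU₀
      map := hierFrameGLMap F N k U₀
      inv := hierFrameGLInv F N k U₀
      analyticAt_map := fun V hV => analyticAt_pi_iff.2 fun y => (analyticAt_hierFrameGL F N k U₀ hV y).1
      analyticAt_inv := fun V hV => analyticAt_pi_iff.2 fun y => (analyticAt_hierFrameGL F N k U₀ hV y).2
      map_mul_inv := fun V _ => funext fun y => hierFrameGLMap_mul_inv F N k U₀ V y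
      map_bg := hierFrameGLMap_coeField F N U₀ hU₀
      deriv := fderiv ℂ (hierFrameGLMap F N k U₀) (coeField U₀)
      hasFDerivAt_map :=
        ((analyticAt_pi_iff.2 fun y => (analyticAt_hierFrameGL F N k U₀ (coeField_mem_hierFrameGLDom F N U₀ hU₀) y).1).differentiableAt).hasFDerivAt }
  else FrameDatum.frameless k U₀

/-- OFF THE GUARD the completed datum is the frameless one (honest vacuity edge). [cite: Balaban1985Averaging, (92) p.31 (bookkeeping)] -/
theorem hierFrameGLDatumOfRecord_of_not_smallBelow (h : ¬ SmallBelow (avOfRecord F N K) k U₀) :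
    hierFrameGLDatumOfRecord F N k U₀ = FrameDatum.frameless k U₀ := by
  rw [hierFrameGLDatumOfRecord]
  exact dif_neg h

/-- ON THE GUARD: the window. [cite: Balaban1985Averaging, (81) p.30 (bookkeeping)] -/
theorem hierFrameGLDatumOfRecord_dom (hU₀ : SmallBelow (avOfRecord F N K) k U₀) : (hierFrameGLDatumOfRecord F N k U₀).dom = hierFrameGLDom F N k U₀ := by
  rw [hierFrameGLDatumOfRecord, dif_pos hU₀]

/-- ON THE GUARD: the frame map. [cite: Balaban1985Averaging, (87) p.31 (bookkeeping)] -/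
theorem hierFrameGLDatumOfRecord_map (hU₀ : SmallBelow (avOfRecord F N K) k U₀) : (hierFrameGLDatumOfRecord F N k U₀).map = hierFrameGLMap F N k U₀ := by
  rw [hierFrameGLDatumOfRecord, dif_pos hU₀]

/-- ON THE GUARD: the inverse frame. [cite: Balaban1985Averaging, (86) p.31 (bookkeeping)] -/
theorem hierFrameGLDatumOfRecord_inv (hU₀ : SmallBelow (avOfRecord F N K) k U₀) : (hierFrameGLDatumOfRecord F N k U₀).inv = hierFrameGLInv F N k U₀ := by
  rw [hierFrameGLDatumOfRecord, dif_pos hU₀]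

/-- ON THE GUARD: the derivative letter is `fderiv ℂ map (↑U₀)`. [cite: Balaban1985BackgroundPropagators, (3.113) p.418 (bookkeeping)] -/
theorem hierFrameGLDatumOfRecord_deriv (hU₀ : SmallBelow (avOfRecord F N K) k U₀) :
    (hierFrameGLDatumOfRecord F N k U₀).deriv = fderiv ℂ (hierFrameGLMap F N k U₀) (coeField U₀) := by
  rw [hierFrameGLDatumOfRecord, dif_pos hU₀]

/-! ### §3b. Agreement with file A1 on fields of vanishing determinant coordinate -/

/-- ★ **ON FIELDS WITH `σ_V = 0` (e.g. `V(b)U₀(b)⋆ ∈ SL(N, ℂ)` inside the log-discs) THE COMPLETED FRAME IS A1's FRAME `Ψ_k(V)`** — the completion changes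
nothing on print's `Gᶜ = SL(N, ℂ)`-valued configurations. [cite: Balaban1985Averaging, (87) p.31; Balaban1985Variational, p.307] -/
theorem hierFrameGLMap_of_detLogField_eq_zero {V : PBond (F.P K) 0 → Matrix (Fin N) (Fin N) ℂ} (hσ : detLogField U₀ V = 0) :
    hierFrameGLMap F N k U₀ V = fun y => (framePair (avOfRecord F N K) U₀ V k y).2 := by
  funext y
  rw [hierFrameGLMap, hσ, map_zero, Pi.zero_apply, neg_zero, Complex.exp_zero, one_smul, naturalField_of_detLogField_eq_zero U₀ hσ]

/-- Same for the inverse frame: `σ_V = 0 ⟹ h(V)⁻¹ = Φ_k(V)`. [cite: Balaban1985Averaging, (86) p.31; Balaban1985Variational, p.307] -/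
theorem hierFrameGLInv_of_detLogField_eq_zero {V : PBond (F.P K) 0 → Matrix (Fin N) (Fin N) ℂ} (hσ : detLogField U₀ V = 0) :
    hierFrameGLInv F N k U₀ V = fun y => (framePair (avOfRecord F N K) U₀ V k y).1 := by
  funext y
  rw [hierFrameGLInv, hσ, map_zero, Pi.zero_apply, Complex.exp_zero, one_smul, naturalField_of_detLogField_eq_zero U₀ hσ]

/-- ★ **THE TWO DATA OF RECORD AGREE ON `σ_V = 0`**: under the guard, `𝔥ᴳᴸ.map V = 𝔥.map V` and `𝔥ᴳᴸ.inv V = 𝔥.inv V` (A1's `hierFrameDatumOfRecord`) whenever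
`σ_V = 0`. [cite: Balaban1985Averaging, (86)–(87) p.31; Balaban1985Variational, p.307] -/
theorem hierFrameGLDatumOfRecord_eq_hierFrame_of_detLogField_eq_zero (hU₀ : SmallBelow (avOfRecord F N K) k U₀)
    {V : PBond (F.P K) 0 → Matrix (Fin N) (Fin N) ℂ} (hσ : detLogField U₀ V = 0) :
    (hierFrameGLDatumOfRecord F N k U₀).map V = (hierFrameDatumOfRecord F N k U₀).map V ∧
      (hierFrameGLDatumOfRecord F N k U₀).inv V = (hierFrameDatumOfRecord F N k U₀).inv V := by
  rw [hierFrameGLDatumOfRecord_map F N k U₀ hU₀, hierFrameGLDatumOfRecord_inv F N k U₀ hU₀, hierFrameDatumOfRecord_map F N k U₀ hU₀,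
    hierFrameDatumOfRecord_inv F N k U₀ hU₀]
  exact ⟨hierFrameGLMap_of_detLogField_eq_zero F N k U₀ hσ, hierFrameGLInv_of_detLogField_eq_zero F N k U₀ hσ⟩

/-! ## §4. (F1) for every matrix direction -/

/-- A1's germ, read on the Fréchet derivative of `Ψ_k`: for TRACELESS `λ₀`, `DΨ_k(↑U₀)[λ₀(b₋)U₀ − U₀λ₀(b₊)] = −(λ₀∘emb^k − Q′_kλ₀)`.
[cite: Balaban1985BackgroundPropagators, (3.113)–(3.114) p.418; Balaban1985Averaging, (87) p.31] -/
theorem fderiv_framePair_snd_velocity (hU₀ : SmallBelow (avOfRecord F N K) k U₀) {lam0 : Site (F.P K) 0 → Matrix (Fin N) (Fin N) ℂ}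
    (hlam0 : ∀ x, (lam0 x).trace = 0) :
    fderiv ℂ (fun (V : PBond (F.P K) 0 → Matrix (Fin N) (Fin N) ℂ) (y : Site (F.P K) k) => (framePair (avOfRecord F N K) U₀ V k y).2) (coeField U₀)
        (fun b : PBond (F.P K) 0 => lam0 b.src * (U₀ b : Matrix (Fin N) (Fin N) ℂ) - (U₀ b : Matrix (Fin N) (Fin N) ℂ) * lam0 b.tgt) =
      fun y => -(lam0 (embIter k y) - siteAvgIter (avOfRecord F N K) U₀ k lam0 y) := by
  have h := hierFrame_deriv_gauge F N k U₀ hU₀ hlam0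
  rw [hierFrameDatumOfRecord_deriv F N k U₀ hU₀, leftVelC_covGrad, map_neg, neg_eq_iff_eq_neg] at h
  rw [h]
  funext y
  rfl

/-- ★★ **THE COMPLETED FRAME ALONG THE GAUGE ORBIT**: for EVERY `λ : sites → M_N(ℂ)`, `d/dt|₀ h((exp tλ)•↑U₀)(y) = −(λ(emb^k y) − (Q′_kλ)(y))` — the scalar
channel `φ = N⁻¹ tr λ` through `σ` and `abFrameL_abGrad` (`M_kφ − φ∘emb^k`), the traceless channel `λ₀ = λ − φ·1` through `♮` and A1's germ, and
`Q′_k(φ·1) = (M_kφ)·1`. [cite: Balaban1985BackgroundPropagators, (3.113)–(3.114) p.418, (3.18)–(3.19) p.393; Balaban1985Averaging, (84)–(87) pp.30–31] -/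
theorem hasDerivAt_hierFrameGLMap_slOrbit (hU₀ : SmallBelow (avOfRecord F N K) k U₀) (lam : Site (F.P K) 0 → Matrix (Fin N) (Fin N) ℂ) :
    HasDerivAt (fun t : ℂ => hierFrameGLMap F N k U₀ (slOrbit U₀ lam t))
      (fun y => -(lam (embIter k y) - siteAvgIter (avOfRecord F N K) U₀ k lam y)) 0 := by
  -- the scalar part `φ = N⁻¹ tr λ` and the traceless part `λ₀ = λ − φ·1`
  set φ : Site (F.P K) 0 → ℂ := fun x => ((N : ℂ))⁻¹ * (lam x).trace with hφ
  set lam0 : Site (F.P K) 0 → Matrix (Fin N) (Fin N) ℂ := fun x => lam x - φ x • (1 : Matrix (Fin N) (Fin N) ℂ) with hlam0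
  have hN : (N : ℂ) ≠ 0 := Nat.cast_ne_zero.2 (NeZero.ne N)
  have hlam0tr : ∀ x, (lam0 x).trace = 0 := fun x => by
    simp only [hlam0, hφ]
    rw [Matrix.trace_sub, Matrix.trace_smul, Matrix.trace_one, Fintype.card_fin, smul_eq_mul, mul_right_comm, inv_mul_cancel₀ hN, one_mul, sub_self]
  have hdecomp : ∀ x, lam x = lam0 x + φ x • (1 : Matrix (Fin N) (Fin N) ℂ) := fun x => by simp only [hlam0, sub_add_cancel]
  -- (a) the Fréchet derivative of `Ψ_k` at `↑U₀` and the curve `t ↦ ((exp tλ)•↑U₀)♮`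
  have hΨ : HasFDerivAt (fun (V : PBond (F.P K) 0 → Matrix (Fin N) (Fin N) ℂ) (y : Site (F.P K) k) => (framePair (avOfRecord F N K) U₀ V k y).2)
      (fderiv ℂ (fun (V : PBond (F.P K) 0 → Matrix (Fin N) (Fin N) ℂ) (y : Site (F.P K) k) => (framePair (avOfRecord F N K) U₀ V k y).2) (coeField U₀))
      (coeField U₀) :=
    ((analyticAt_pi_iff.2 fun y =>
        (analyticAt_framePair (avOfRecord F N K) U₀ k (coeField_mem_hierFrameDom F N U₀ hU₀) y).2).differentiableAt).hasFDerivAt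
  have hnat := hasDerivAt_naturalField_slOrbit U₀ lam
  have hnat0 : naturalField U₀ (slOrbit U₀ lam 0) = coeField U₀ := by rw [slOrbit_zero, naturalField_coeField]
  have hvel : (fun b : PBond (F.P K) 0 =>
        (lam b.src - (((N : ℂ))⁻¹ * (lam b.src).trace) • (1 : Matrix (Fin N) (Fin N) ℂ)) * (U₀ b : Matrix (Fin N) (Fin N) ℂ) -
          (U₀ b : Matrix (Fin N) (Fin N) ℂ) * (lam b.tgt - (((N : ℂ))⁻¹ * (lam b.tgt).trace) • (1 : Matrix (Fin N) (Fin N) ℂ))) =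
      fun b : PBond (F.P K) 0 => lam0 b.src * (U₀ b : Matrix (Fin N) (Fin N) ℂ) - (U₀ b : Matrix (Fin N) (Fin N) ℂ) * lam0 b.tgt := by
    funext b; simp only [hlam0, hφ]
  rw [hvel] at hnat
  have hG : HasDerivAt (fun t : ℂ => fun y : Site (F.P K) k => (framePair (avOfRecord F N K) U₀ (naturalField U₀ (slOrbit U₀ lam t)) k y).2)
      (fun y => -(lam0 (embIter k y) - siteAvgIter (avOfRecord F N K) U₀ k lam0 y)) 0 := by
    have h := hΨ.comp_hasDerivAt_of_eq (0 : ℂ) hnat hnat0.symm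
    rw [fderiv_framePair_snd_velocity F N k U₀ hU₀ hlam0tr] at h
    exact h
  -- (b) the scalar prefactor
  have hσ : HasDerivAt (fun t : ℂ => detLogField U₀ (slOrbit U₀ lam t)) (fun b : PBond (F.P K) 0 => ((N : ℂ))⁻¹ * ((lam b.src).trace - (lam b.tgt).trace)) 0 :=
    hasDerivAt_pi.2 fun b => hasDerivAt_detLogField_slOrbit U₀ lam b
  have hσgrad : (fun b : PBond (F.P K) 0 => ((N : ℂ))⁻¹ * ((lam b.src).trace - (lam b.tgt).trace)) = -abGrad φ := by
    funext b
    simp only [Pi.neg_apply, abGrad_apply, hφ]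
    ring
  have hσ0 : detLogField U₀ (slOrbit U₀ lam 0) = 0 := by rw [slOrbit_zero, detLogField_coeField]
  refine hasDerivAt_pi.2 fun y => ?_
  have hf : HasDerivAt (fun t : ℂ => abFrameL k (detLogField U₀ (slOrbit U₀ lam t)) y) (-(blockMeanIter k φ y - φ (embIter k y))) 0 := by
    have h := (LinearMap.toContinuousLinearMap ((LinearMap.proj y : (Site (F.P K) k → ℂ) →ₗ[ℂ] ℂ) ∘ₗ abFrameL k)).hasFDerivAt.comp_hasDerivAt (0 : ℂ) hσ
    rw [hσgrad] at h
    have hval : (LinearMap.toContinuousLinearMap ((LinearMap.proj y : (Site (F.P K) k → ℂ) →ₗ[ℂ] ℂ) ∘ₗ abFrameL k)) (-abGrad φ) =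
        -(blockMeanIter k φ y - φ (embIter k y)) := by
      rw [LinearMap.coe_toContinuousLinearMap', map_neg, LinearMap.comp_apply, abFrameL_abGrad]
      rfl
    rw [hval] at h
    exact h
  have hpre : HasDerivAt (fun t : ℂ => Complex.exp (-abFrameL k (detLogField U₀ (slOrbit U₀ lam t)) y)) (blockMeanIter k φ y - φ (embIter k y)) 0 := by
    have h := hf.neg.cexp
    simp only [Pi.neg_apply, hσ0, map_zero, Pi.zero_apply, neg_zero, Complex.exp_zero, one_mul, neg_neg] at h
    exact h
  -- (c) the product
  have hGy := (hasDerivAt_pi.1 hG) y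
  have hprod := hpre.smul hGy
  have hG0 : (framePair (avOfRecord F N K) U₀ (naturalField U₀ (slOrbit U₀ lam 0)) k y).2 = 1 := by
    rw [hnat0, framePair_coeField_of_smallBelow F N U₀ hU₀ k le_rfl]
  simp only [hσ0, map_zero, Pi.zero_apply, neg_zero, Complex.exp_zero, one_smul, hG0] at hprod
  have hQ : siteAvgIter (avOfRecord F N K) U₀ k lam y = siteAvgIter (avOfRecord F N K) U₀ k lam0 y + blockMeanIter k φ y • (1 : Matrix (Fin N) (Fin N) ℂ) := by
    have hl : lam = lam0 + fun x => φ x • (1 : Matrix (Fin N) (Fin N) ℂ) := funext fun x => hdecomp x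
    rw [hl, map_add, Pi.add_apply, siteAvgIter_smul_one]
  have he : -(lam (embIter k y) - siteAvgIter (avOfRecord F N K) U₀ k lam y) =
      -(lam0 (embIter k y) - siteAvgIter (avOfRecord F N K) U₀ k lam0 y) + (blockMeanIter k φ y - φ (embIter k y)) • (1 : Matrix (Fin N) (Fin N) ℂ) := by
    rw [hQ, hdecomp (embIter k y), sub_smul]
    abel
  rw [he]
  exact hprod

/-- ★★★ **(F1) FOR EVERY MATRIX DIRECTION — THE GERM OF THE COMPLETED FRAME ALONG GAUGE ORBITS IS CENTRE VALUE MINUS PRINT'S BLOCK MEAN**: under the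
record's guard below `k`, for every `λ : sites → M_N(ℂ)` (no trace hypothesis), the derivative letter of `hierFrameGLDatumOfRecord` maps the chart direction
`leftVelC U₀ (D_{U₀}λ)`, `(D_{U₀}λ)(b) = U₀(b)λ(b₊)U₀(b)⋆ − λ(b₋)`, to `λ∘emb^k − Q′_kλ` (`Q′_k = siteAvgIter`, (3.19)).
[cite: Balaban1985BackgroundPropagators, (3.113)–(3.114) p.418, (3.18)–(3.19) p.393; Balaban1985Averaging, (84)–(87) pp.30–31; Balaban1985Variational, p.307] -/
theorem hierFrameGL_deriv_gauge (hU₀ : SmallBelow (avOfRecord F N K) k U₀) (lam : Site (F.P K) 0 → Matrix (Fin N) (Fin N) ℂ) :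
    (hierFrameGLDatumOfRecord F N k U₀).deriv
        (leftVelC U₀ fun b : PBond (F.P K) 0 => (U₀ b : Matrix (Fin N) (Fin N) ℂ) * lam b.tgt * star (U₀ b : Matrix (Fin N) (Fin N) ℂ) - lam b.src) =
      fun y => lam (embIter k y) - siteAvgIter (avOfRecord F N K) U₀ k lam y := by
  have hF := (hierFrameGLDatumOfRecord F N k U₀).hasFDerivAt_map
  have hcomp : HasDerivAt (fun t : ℂ => (hierFrameGLDatumOfRecord F N k U₀).map (slOrbit U₀ lam t))
      ((hierFrameGLDatumOfRecord F N k U₀).deriv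
        fun b : PBond (F.P K) 0 => lam b.src * (U₀ b : Matrix (Fin N) (Fin N) ℂ) - (U₀ b : Matrix (Fin N) (Fin N) ℂ) * lam b.tgt) 0 :=
    hF.comp_hasDerivAt_of_eq (0 : ℂ) (hasDerivAt_slOrbit_zero U₀ lam) (slOrbit_zero U₀ lam).symm
  have horb : HasDerivAt (fun t : ℂ => (hierFrameGLDatumOfRecord F N k U₀).map (slOrbit U₀ lam t))
      (fun y => -(lam (embIter k y) - siteAvgIter (avOfRecord F N K) U₀ k lam y)) 0 := by
    simp only [hierFrameGLDatumOfRecord_map F N k U₀ hU₀]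
    exact hasDerivAt_hierFrameGLMap_slOrbit F N k U₀ hU₀ lam
  have huniq := hcomp.unique horb
  rw [leftVelC_covGrad, map_neg, huniq]
  funext y
  rw [Pi.neg_apply, neg_neg]

/-! ## §5. (3.114) on `𝔰𝔩_N`-valued `λ` for the completed datum -/

/-- ★★ **(3.114) FOR THE COMPLETED FRAME ON TRACELESS `λ`**: `Q^{pr}_k(U₀)(D_{U₀}λ)(c) = L^{-k}·(Ū₀(c)·(Q′_kλ)(c₊)·Ū₀(c)⋆ − (Q′_kλ)(c₋))` — (F1) for the completed
datum and the un-framed identity `q^{ff}(D_{U₀}λ) = L^{-k}·D_{Ū₀}(λ∘emb^k)` on `𝔰𝔩_N` (A1's `qCplxOp_covGrad_of_trace_zero_record`).  The scalar channel of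
the all-matrix display needs the un-framed scalar row, which is Summits-side (module docstring). [cite: Balaban1985BackgroundPropagators, (3.113)–(3.115) p.418, (3.18)–(3.19) p.393] -/
theorem frameIntertwinesTokSL_hierFrameGL (hU₀ : SmallBelow (avOfRecord F N K) k U₀) :
    FrameIntertwinesTokSL F N k U₀ (hierFrameGLDatumOfRecord F N k U₀) := by
  intro lam hlam c
  have hit : iterM k (coeField U₀) = coeField (Averaging.iter (avOfRecord F N K) k U₀) := (coeField_iter_eq_iterM k hU₀).symm
  rw [qPrCplxOp_apply, Pi.sub_apply, hierFrameGL_deriv_gauge F N k U₀ hU₀ lam, frameCorr_apply, qCplxOp_covGrad_of_trace_zero_record F N k U₀ hU₀ hlam c,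
    hit, coeField_apply, ← smul_sub]
  congr 1
  simp only [mul_sub, sub_mul]
  abel

/-- ★★ **THE ALL-MATRIX DISPLAY REDUCED TO ITS UN-FRAMED SCALAR ROW**: if the un-framed linearised averaging carries the scalar pure gauge `D_{U₀}(φ·1)` to
`L^{-k}·(φ(emb^k c₊) − φ(emb^k c₋))·1` (the `U(1)`-phase covariance of (0.4), a Summits-side theorem of the N07 trace-sector files), then file A2's
`FrameIntertwinesTok F N k U₀` HOLDS for the completed datum — by (F1) for every `λ`, A1's traceless row, linearity, and `Q′_k(φ·1) = (M_kφ)·1`.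
[cite: Balaban1985BackgroundPropagators, (3.113)–(3.115) p.418, (3.13) p.393, (3.18)–(3.19) p.393; Balaban1985Averaging, (11) p.19] -/
theorem frameIntertwinesTok_hierFrameGL_of_scalarRow (hU₀ : SmallBelow (avOfRecord F N K) k U₀)
    (hsc : ∀ (φ : Site (F.P K) 0 → ℂ) (c : PBond (F.P K) k),
      qCplxOp k U₀ (fun b : PBond (F.P K) 0 =>
          (U₀ b : Matrix (Fin N) (Fin N) ℂ) * (φ b.tgt • (1 : Matrix (Fin N) (Fin N) ℂ)) * star (U₀ b : Matrix (Fin N) (Fin N) ℂ) -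
            φ b.src • (1 : Matrix (Fin N) (Fin N) ℂ)) c =
        (((F.P K).L : ℂ) ^ k)⁻¹ • ((φ (embIter k c.tgt) - φ (embIter k c.src)) • (1 : Matrix (Fin N) (Fin N) ℂ))) :
    FrameIntertwinesTok F N k U₀ (hierFrameGLDatumOfRecord F N k U₀) := by
  intro lam c
  set φ : Site (F.P K) 0 → ℂ := fun x => ((N : ℂ))⁻¹ * (lam x).trace with hφ
  set lam0 : Site (F.P K) 0 → Matrix (Fin N) (Fin N) ℂ := fun x => lam x - φ x • (1 : Matrix (Fin N) (Fin N) ℂ) with hlam0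
  have hN : (N : ℂ) ≠ 0 := Nat.cast_ne_zero.2 (NeZero.ne N)
  have hlam0tr : ∀ x, (lam0 x).trace = 0 := fun x => by
    simp only [hlam0, hφ]
    rw [Matrix.trace_sub, Matrix.trace_smul, Matrix.trace_one, Fintype.card_fin, smul_eq_mul, mul_right_comm, inv_mul_cancel₀ hN, one_mul, sub_self]
  have hl : lam = lam0 + fun x => φ x • (1 : Matrix (Fin N) (Fin N) ℂ) := funext fun x => by simp only [hlam0, Pi.add_apply, sub_add_cancel]
  -- the direction `D_{U₀}λ` splits linearly
  have hdir : (fun b : PBond (F.P K) 0 => (U₀ b : Matrix (Fin N) (Fin N) ℂ) * lam b.tgt * star (U₀ b : Matrix (Fin N) (Fin N) ℂ) - lam b.src) =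
      (fun b : PBond (F.P K) 0 => (U₀ b : Matrix (Fin N) (Fin N) ℂ) * lam0 b.tgt * star (U₀ b : Matrix (Fin N) (Fin N) ℂ) - lam0 b.src) +
        fun b : PBond (F.P K) 0 =>
          (U₀ b : Matrix (Fin N) (Fin N) ℂ) * (φ b.tgt • (1 : Matrix (Fin N) (Fin N) ℂ)) * star (U₀ b : Matrix (Fin N) (Fin N) ℂ) -
            φ b.src • (1 : Matrix (Fin N) (Fin N) ℂ) := by
    funext b
    simp only [Pi.add_apply, hl, Matrix.mul_add, Matrix.add_mul]
    abel
  have hSL := frameIntertwinesTokSL_hierFrameGL F N k U₀ hU₀ lam0 hlam0tr c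
  -- the scalar channel: framed = un-framed scalar row − frameCorr((F1) on φ·1)
  have hit : iterM k (coeField U₀) = coeField (Averaging.iter (avOfRecord F N K) k U₀) := (coeField_iter_eq_iterM k hU₀).symm
  have hscal : qPrCplxOp k U₀ (hierFrameGLDatumOfRecord F N k U₀)
      (fun b : PBond (F.P K) 0 =>
        (U₀ b : Matrix (Fin N) (Fin N) ℂ) * (φ b.tgt • (1 : Matrix (Fin N) (Fin N) ℂ)) * star (U₀ b : Matrix (Fin N) (Fin N) ℂ) -
          φ b.src • (1 : Matrix (Fin N) (Fin N) ℂ)) c =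
      (((F.P K).L : ℂ) ^ k)⁻¹ •
        (((Averaging.iter (avOfRecord F N K) k U₀ c : SU N) : Matrix (Fin N) (Fin N) ℂ) *
              siteAvgIter (avOfRecord F N K) U₀ k (fun x => φ x • (1 : Matrix (Fin N) (Fin N) ℂ)) c.tgt *
            star ((Averaging.iter (avOfRecord F N K) k U₀ c : SU N) : Matrix (Fin N) (Fin N) ℂ) -
          siteAvgIter (avOfRecord F N K) U₀ k (fun x => φ x • (1 : Matrix (Fin N) (Fin N) ℂ)) c.src) := by
    rw [qPrCplxOp_apply, Pi.sub_apply, hierFrameGL_deriv_gauge F N k U₀ hU₀ (fun x => φ x • (1 : Matrix (Fin N) (Fin N) ℂ)), frameCorr_apply, hsc φ c,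
      hit, coeField_apply, siteAvgIter_smul_one, ← smul_sub]
    congr 1
    simp only [Matrix.mul_sub, Matrix.sub_mul, Matrix.mul_smul, Matrix.smul_mul, mul_one, coe_mul_star_coe_SU, sub_smul]
    abel
  rw [hdir, map_add, Pi.add_apply, hSL, hscal, ← smul_add, hl]
  congr 1
  simp only [map_add, Pi.add_apply, Matrix.mul_add, Matrix.add_mul]
  abel

end RecordGL

end Literature.MathematicalPhysics.QuantumFieldTheory.Balaban1983to89.Node00

end
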